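import Literature.Computability.Complexity.GraphCanonizationScheme
import HarnessLib

/-!
# The section/individualization canoniser: label-invariance of its ingredients, and pasting codes

Toolkit for the correctness proof (`GraphCanonizationSchemeCorrect.lean`) of the canoniser
`CGCanon.canon` (`GraphCanonizationScheme.lean`), after [Laubner2011, §3.4] /
[CorneilGoldberg1984]:

* LABEL-INVARIANCE, in pullback form along `e : Equiv.Perm (Fin k)` — the state
  `(G.comap e, W, c')` with `c' = c ∘ e` on `W` versus `(G, W.map e, c)`: cells, cell keys, the
  branching cell (`bigMinCell_comap`), individualization, the lifted colouring, the switch bits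
  (`switch_comap_iff'`), the switched graph (`swG_comap_adj`), reachability, components, parts,
  connectivity, equitability (`isEqui_comap_iff`), and codes (`code_comap`);
* `canon R G W c` is an ordering of `W` (`canon_perm_sort`: a permutation of `W.sort`);
* **pasting codes** (`code_append`): if across `A` and `B` adjacency is a function `S` of the two
  colours, the code of `A ++ B` is `combine S (code A) (code B)` — the computation behind
  [Laubner2011, Thm. 3.4.3] ("the edge relation between vertices from different `C_Q` is
  determined from the colouring").

## References

* B. Laubner, PhD thesis, HU Berlin 2011, doi:10.18452/16335, §3.4, Thm. 3.4.3. [Laubner2011]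
* D. G. Corneil, M. K. Goldberg, J. Algorithms 5 (1984) 345–362. [CorneilGoldberg1984]
-/

namespace Literature.Computability.Complexity

open Literature.Combinatorics.SimpleGraph Finset ColourRefinementScheme

open scoped Classical

noncomputable section

namespace CGCanon

variable {k : ℕ} {G : SimpleGraph (Fin k)} {e : Equiv.Perm (Fin k)} {W : Finset (Fin k)} {c c' : Fin k → ℕ}

/-! ### Label-invariance of the state notions -/

section Comap

/-- `e v ∈ W.map e ↔ v ∈ W`. [folklore] -/
theorem mem_map_perm_iff (e : Equiv.Perm (Fin k)) (W : Finset (Fin k)) (v : Fin k) : e v ∈ W.map e.toEmbedding ↔ v ∈ W :=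
  mem_map' _

/-- Membership in `W.map e` through `e.symm`. [folklore] -/
theorem mem_map_perm_iff_symm (e : Equiv.Perm (Fin k)) (W : Finset (Fin k)) (v : Fin k) :
    v ∈ W.map e.toEmbedding ↔ e.symm v ∈ W := by
  rw [← mem_map_perm_iff e W (e.symm v), Equiv.apply_symm_apply]

variable (hc : ∀ v ∈ W, c' v = c (e v))
include hc

/-- Cells correspond. [folklore] -/
theorem cell_comap {v : Fin k} (hv : v ∈ W) : (cell W c' v).map e.toEmbedding = cell (W.map e.toEmbedding) c (e v) := by
  ext w
  rw [mem_map_perm_iff_symm, mem_cell, mem_cell, mem_map_perm_iff_symm]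
  constructor
  · rintro ⟨hw, hcw⟩
    exact ⟨hw, by rw [← hc v hv, ← hcw, hc _ hw, Equiv.apply_symm_apply]⟩
  · rintro ⟨hw, hcw⟩
    exact ⟨hw, by rw [hc _ hw, hc v hv, Equiv.apply_symm_apply, hcw]⟩

/-- Cell sizes correspond. [folklore] -/
theorem card_cell_comap {v : Fin k} (hv : v ∈ W) : (cell W c' v).card = (cell (W.map e.toEmbedding) c (e v)).card := by
  rw [← cell_comap hc hv, card_map]

/-- Cell keys correspond. [folklore] -/
theorem cellKey_comap {v : Fin k} (hv : v ∈ W) : cellKey W c' v = cellKey (W.map e.toEmbedding) c (e v) := by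
  simp only [cellKey, card_cell_comap hc hv, hc v hv]

/-- **The branching cells correspond.** [folklore] -/
theorem bigMinCell_comap : (bigMinCell W c').map e.toEmbedding = bigMinCell (W.map e.toEmbedding) c := by
  ext w
  rw [mem_map_perm_iff_symm, mem_bigMinCell, mem_bigMinCell, mem_map_perm_iff_symm]
  constructor
  · rintro ⟨hw, h2, hmin⟩
    refine ⟨hw, ?_, fun u hu hu2 => ?_⟩
    · rwa [card_cell_comap hc hw, Equiv.apply_symm_apply] at h2
    · rw [mem_map_perm_iff_symm] at hu
      have h := hmin (e.symm u) hu (by rwa [card_cell_comap hc hu, Equiv.apply_symm_apply])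
      rwa [cellKey_comap hc hw, cellKey_comap hc hu, Equiv.apply_symm_apply, Equiv.apply_symm_apply] at h
  · rintro ⟨hw, h2, hmin⟩
    refine ⟨hw, ?_, fun u hu hu2 => ?_⟩
    · rwa [card_cell_comap hc hw, Equiv.apply_symm_apply]
    · have h := hmin (e u) ((mem_map_perm_iff e W u).2 hu) (by rwa [← card_cell_comap hc hu])
      rwa [cellKey_comap hc hw, cellKey_comap hc hu, Equiv.apply_symm_apply]

/-- Membership in the branching cells corresponds. [folklore] -/
theorem mem_bigMinCell_comap_iff (v : Fin k) : v ∈ bigMinCell W c' ↔ e v ∈ bigMinCell (W.map e.toEmbedding) c := by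
  rw [← bigMinCell_comap hc, mem_map_perm_iff]

/-- Individualized colourings correspond on `W`. [folklore] -/
theorem individualize_comap (x : Fin k) : ∀ v ∈ W, individualize c' x v = individualize c (e x) (e v) := by
  intro v hv
  simp only [individualize, e.injective.eq_iff, hc v hv]

/-- The lifted colourings correspond (everywhere). [folklore] -/
theorem liftCol_comap (v : Fin k) : liftCol W c' v = liftCol (W.map e.toEmbedding) c (e v) := by
  by_cases hv : v ∈ W
  · rw [liftCol_of_mem c' hv, liftCol_of_mem c ((mem_map_perm_iff e W v).2 hv), hc v hv]
  · rw [liftCol_of_not_mem c' hv, liftCol_of_not_mem c (fun h => hv ((mem_map_perm_iff e W v).1 h))]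

omit hc in
/-- The state graphs correspond. [folklore] -/
theorem within_comap_adj (u v : Fin k) : (within (G.comap e) W).Adj u v ↔ (within G (W.map e.toEmbedding)).Adj (e u) (e v) := by
  simp only [within_adj, SimpleGraph.comap_adj, mem_map_perm_iff]

/-- The switch bits correspond. [folklore] -/
theorem switch_comap_iff' (a b : ℕ) :
    Switch (within (G.comap e) W) (liftCol W c') a b ↔ Switch (within G (W.map e.toEmbedding)) (liftCol (W.map e.toEmbedding) c) a b := by
  have h1 : ∀ d, cellCard (liftCol W c') d = cellCard (liftCol (W.map e.toEmbedding) c) d := fun d =>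
    card_equiv e fun w => by simp [liftCol_comap hc]
  have h2 : crossEdges (within (G.comap e) W) (liftCol W c') a b =
      crossEdges (within G (W.map e.toEmbedding)) (liftCol (W.map e.toEmbedding) c) a b :=
    card_equiv (Equiv.prodCongr e e) fun p => by simp [liftCol_comap hc]
  unfold Switch
  rw [h1, h1, h2]

/-- **The switched graphs correspond.** [folklore] -/
theorem swG_comap_adj (u v : Fin k) : (swG (G.comap e) W c').Adj u v ↔ (swG G (W.map e.toEmbedding) c).Adj (e u) (e v) := by
  by_cases hu : u ∈ W
  · by_cases hv : v ∈ W
    · rw [swG_adj_iff hu hv, swG_adj_iff ((mem_map_perm_iff e W u).2 hu) ((mem_map_perm_iff e W v).2 hv),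
        e.injective.ne_iff, SimpleGraph.comap_adj, switch_comap_iff' hc, liftCol_comap hc, liftCol_comap hc]
    · exact iff_of_false (fun h => hv (swG_mem h).2) fun h => hv ((mem_map_perm_iff e W v).1 (swG_mem h).2)
  · exact iff_of_false (fun h => hu (swG_mem h).1) fun h => hu ((mem_map_perm_iff e W u).1 (swG_mem h).1)

/-- The switched graphs are isomorphic along `e`. [folklore] -/
def swGIso : swG (G.comap e) W c' ≃g swG G (W.map e.toEmbedding) c := ⟨e, (swG_comap_adj hc _ _).symm⟩

/-- Reachability corresponds. [folklore] -/
theorem reachable_comap_iff (u v : Fin k) :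
    (swG (G.comap e) W c').Reachable u v ↔ (swG G (W.map e.toEmbedding) c).Reachable (e u) (e v) :=
  (SimpleGraph.Iso.reachable_iff (φ := swGIso hc)).symm

/-- **Components correspond.** [folklore] -/
theorem comp_comap (u : Fin k) : (comp (G.comap e) W c' u).map e.toEmbedding = comp G (W.map e.toEmbedding) c (e u) := by
  ext w
  rw [mem_map_perm_iff_symm, mem_comp, mem_comp, mem_map_perm_iff_symm, reachable_comap_iff hc, Equiv.apply_symm_apply]

/-- **Parts correspond.** [folklore] -/
theorem parts_comap : (parts (G.comap e) W c').image (fun K => K.map e.toEmbedding) = parts G (W.map e.toEmbedding) c := by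
  ext K
  simp only [parts, mem_image, mem_map_equiv, exists_exists_and_eq_and]
  constructor
  · rintro ⟨u, hu, rfl⟩
    exact ⟨e u, by simpa using hu, (comp_comap hc u).symm⟩
  · rintro ⟨u, hu, rfl⟩
    exact ⟨e.symm u, hu, by rw [comp_comap hc, Equiv.apply_symm_apply]⟩

/-- A part of the pulled-back state maps to a part. [folklore] -/
theorem map_mem_parts {K : Finset (Fin k)} (hK : K ∈ parts (G.comap e) W c') : K.map e.toEmbedding ∈ parts G (W.map e.toEmbedding) c := by
  rw [← parts_comap hc]; exact mem_image_of_mem _ hK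

/-- **Connectivity corresponds.** [folklore] -/
theorem isConn_comap_iff : IsConn (G.comap e) W c' ↔ IsConn G (W.map e.toEmbedding) c := by
  constructor
  · intro h u hu v hv
    rw [mem_map_perm_iff_symm] at hu hv
    simpa using (reachable_comap_iff hc (e.symm u) (e.symm v)).1 (h hu hv)
  · intro h u hu v hv
    exact (reachable_comap_iff hc u v).2 (h ((mem_map_perm_iff e W u).2 hu) ((mem_map_perm_iff e W v).2 hv))

/-- **Equitability corresponds.** [folklore] -/
theorem isEqui_comap_iff : IsEqui (G.comap e) W c' ↔ IsEqui G (W.map e.toEmbedding) c := by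
  have hg : within (G.comap e) W = (within G (W.map e.toEmbedding)).comap e := by
    ext u v; rw [SimpleGraph.comap_adj]; exact within_comap_adj u v
  have hl : liftCol W c' = liftCol (W.map e.toEmbedding) c ∘ e := funext (liftCol_comap hc)
  unfold IsEqui
  rw [hg, hl]
  constructor
  · intro h u v huv y
    have key := h (e.symm u) (e.symm v) (by simpa using huv) y
    have t : ∀ a : Fin k, {w // ((within G (W.map e.toEmbedding)).comap e).Adj (e.symm a) w ∧
        (liftCol (W.map e.toEmbedding) c ∘ e) w = y} ≃
        {w // (within G (W.map e.toEmbedding)).Adj a w ∧ liftCol (W.map e.toEmbedding) c w = y} := fun a =>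
      { toFun := fun w => ⟨e w.1, by simpa [SimpleGraph.comap_adj] using w.2⟩
        invFun := fun w => ⟨e.symm w.1, by simpa [SimpleGraph.comap_adj] using w.2⟩
        left_inv := fun w => by simp
        right_inv := fun w => by simp }
    rwa [Nat.card_congr (t u), Nat.card_congr (t v)] at key
  · intro h u v huv y
    have key := h (e u) (e v) (by simpa using huv) y
    have t : ∀ a : Fin k, {w // (within G (W.map e.toEmbedding)).Adj (e a) w ∧ liftCol (W.map e.toEmbedding) c w = y} ≃
        {w // ((within G (W.map e.toEmbedding)).comap e).Adj a w ∧ (liftCol (W.map e.toEmbedding) c ∘ e) w = y} := fun a =>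
      { toFun := fun w => ⟨e.symm w.1, by simpa [SimpleGraph.comap_adj] using w.2⟩
        invFun := fun w => ⟨e w.1, by simpa [SimpleGraph.comap_adj] using w.2⟩
        left_inv := fun w => by simp
        right_inv := fun w => by simp }
    rwa [Nat.card_congr (t u), Nat.card_congr (t v)] at key

omit hc in
/-- **Codes correspond**: the code of `ord` in the pulled-back state is the code of `ord.map e`. [folklore] -/
theorem code_comap {ord : List (Fin k)} (hord : ∀ v ∈ ord, c' v = c (e v)) : code (G.comap e) c' ord = code G c (ord.map e) := by
  unfold code
  simp only [List.map_map]
  congr 1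
  refine Prod.ext ?_ ?_
  · refine List.map_congr_left fun u _ => ?_
    simp only [Function.comp_apply]
    exact List.map_congr_left fun v _ => by simp [SimpleGraph.comap_adj]
  · exact List.map_congr_left fun v hv => by simp [hord v hv]

end Comap

/-! ### The canoniser orders `W` -/

/-- The parts of a state are pairwise disjoint. [folklore] -/
theorem disjoint_of_mem_parts {K K' : Finset (Fin k)} (hK : K ∈ parts G W c) (hK' : K' ∈ parts G W c) (hne : K ≠ K') :
    Disjoint K K' := by
  obtain ⟨u, -, rfl⟩ := mem_image.1 hK
  obtain ⟨u', -, rfl⟩ := mem_image.1 hK'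
  rw [disjoint_left]
  intro w hw hw'
  exact hne ((comp_eq_of_mem hw).symm.trans (comp_eq_of_mem hw'))

/-- The parts of a state cover `W`. [folklore] -/
theorem mem_parts_cover {v : Fin k} (hv : v ∈ W) : ∃ K ∈ parts G W c, v ∈ K :=
  ⟨comp G W c v, mem_image_of_mem _ hv, mem_comp_self hv⟩

/-- Parts lie in `W`. [folklore] -/
theorem subset_of_mem_parts {K : Finset (Fin k)} (hK : K ∈ parts G W c) : K ⊆ W := by
  obtain ⟨u, -, rfl⟩ := mem_image.1 hK
  exact comp_subset u

/-- **Pasting orderings of the parts orders `W`**: if `ordOf K` is a permutation of `K.sort` for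
every part, `paste` returns a permutation of `W.sort`. [folklore] -/
theorem paste_perm_sort {ordOf : Finset (Fin k) → List (Fin k)} (h : ∀ K ∈ parts G W c, (ordOf K).Perm (K.sort (· ≤ ·))) :
    (paste G c (parts G W c) ordOf).Perm (W.sort (· ≤ ·)) := by
  unfold paste
  set L := (parts G W c).toList.insertionSort fun K K' => partKey G c ordOf K ≤ partKey G c ordOf K' with hL
  have hLP : L.Perm (parts G W c).toList := List.perm_insertionSort _ _
  have hmem : ∀ K, K ∈ L ↔ K ∈ parts G W c := fun K => by rw [hLP.mem_iff, mem_toList]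
  have hnd : L.Nodup := hLP.nodup_iff.2 (nodup_toList _)
  apply List.perm_of_nodup_nodup_toFinset_eq
  · rw [List.nodup_flatMap]
    refine ⟨fun K hK => ((h K ((hmem K).1 hK)).nodup_iff.2 (sort_nodup _ _)), ?_⟩
    refine List.Pairwise.imp_of_mem ?_ hnd
    intro K K' hK hK' hne
    have hd := disjoint_of_mem_parts ((hmem K).1 hK) ((hmem K').1 hK') hne
    rw [Function.onFun, List.disjoint_left]
    intro v hv hv'
    rw [(h K ((hmem K).1 hK)).mem_iff, mem_sort] at hv
    rw [(h K' ((hmem K').1 hK')).mem_iff, mem_sort] at hv'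
    exact disjoint_left.1 hd hv hv'
  · exact sort_nodup _ _
  · ext v
    simp only [List.mem_toFinset, List.mem_flatMap, mem_sort]
    constructor
    · rintro ⟨K, hK, hv⟩
      rw [(h K ((hmem K).1 hK)).mem_iff, mem_sort] at hv
      exact subset_of_mem_parts ((hmem K).1 hK) hv
    · intro hv
      obtain ⟨K, hK, hvK⟩ := mem_parts_cover (G := G) (c := c) hv
      exact ⟨K, (hmem K).2 hK, by rw [(h K hK).mem_iff, mem_sort]; exact hvK⟩

/-- **`canon R G W c` is an ordering of `W`** (a permutation of its sorted vertex list). [cite: Laubner2011, Thm. 3.4.3] -/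
theorem canon_perm_sort (R : Refiner k) (G : SimpleGraph (Fin k)) (W : Finset (Fin k)) (c : Fin k → ℕ) :
    (canon R G W c).Perm (W.sort (· ≤ ·)) := by
  -- strong induction on the termination measure
  suffices H : ∀ (n m : ℕ) (W : Finset (Fin k)) (c : Fin k → ℕ), W.card = n → W.card - (W.image c).card = m →
      (canon R G W c).Perm (W.sort (· ≤ ·)) from H _ _ W c rfl rfl
  intro n
  induction n using Nat.strong_induction_on with
  | _ n ihn =>
  intro m
  induction m using Nat.strong_induction_on with
  | _ m ihm =>
  intro W c hn hm
  by_cases hW : W.card ≤ 1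
  · rw [canon_of_card_le_one hW]
  · by_cases hconn : IsConn G W c
    · by_cases hA : (bigMinCell W c).Nonempty
      · rw [canon_of_isConn hW hconn hA]
        set S := (bigMinCell W c).attach.image fun x => cand R G W c x.1 with hS
        obtain ⟨x, -, hx⟩ := mem_image.1 (S.min'_mem ((attach_nonempty_iff.2 hA).image _))
        rw [← hx]
        change (canon R G W (R.refine G W (individualize c x.1))).Perm _
        exact ihm _ (hm ▸ measure_lt_of_mem_bigMinCell R G W c x.2) W _ hn rfl
      · rw [canon_of_isConn_of_not_nonempty hW hconn hA]
    · rw [canon_of_not_isConn hW hconn]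
      refine paste_perm_sort fun K hK => ?_
      rw [if_pos hK]
      exact ihn K.card (hn ▸ card_lt_of_mem_parts hconn hK) _ K c rfl rfl

/-- Hence the vertices listed by `canon R G W c` are exactly those of `W`. [folklore] -/
theorem mem_canon_iff (R : Refiner k) (G : SimpleGraph (Fin k)) (W : Finset (Fin k)) (c : Fin k → ℕ) (v : Fin k) :
    v ∈ canon R G W c ↔ v ∈ W := by
  rw [(canon_perm_sort R G W c).mem_iff, mem_sort]

/-- And `canon R G W c` has no duplicates and length `|W|`. [folklore] -/
theorem nodup_canon (R : Refiner k) (G : SimpleGraph (Fin k)) (W : Finset (Fin k)) (c : Fin k → ℕ) :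
    (canon R G W c).Nodup ∧ (canon R G W c).length = W.card :=
  ⟨(canon_perm_sort R G W c).nodup_iff.2 (sort_nodup _ _), by rw [(canon_perm_sort R G W c).length_eq, length_sort]⟩

/-! ### Pasting codes -/

/-- `zipWith` along two maps of the same list. [folklore] -/
private theorem zipWith_map_map {α β γ δ : Type} (f : β → γ → δ) (g : α → β) (h : α → γ) :
    ∀ l : List α, List.zipWith f (l.map g) (l.map h) = l.map fun a => f (g a) (h a)
  | [] => rfl
  | a :: l => by simp [zipWith_map_map f g h l]

/-- **Combining two codes across a colour-determined frontier**: the code of `A ++ B` when the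
adjacency between `A` and `B` is the bit `S (colour of the A-vertex) (colour of the B-vertex)`. [cite: Laubner2011, Thm. 3.4.3] -/
def combine (S : ℕ → ℕ → Bool) (a b : Code) : Code :=
  toLex ((List.zipWith (fun row cu => row ++ (ofLex b).2.map fun cv => S cu cv) (ofLex a).1 (ofLex a).2) ++
      List.zipWith (fun row cv => ((ofLex a).2.map fun cu => S cu cv) ++ row) (ofLex b).1 (ofLex b).2,
    (ofLex a).2 ++ (ofLex b).2)

/-- **Pasting codes**: if `u ~ v ↔ S (c u) (c v)` for all `u ∈ A`, `v ∈ B`, then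
`code (A ++ B) = combine S (code A) (code B)`. [cite: Laubner2011, Thm. 3.4.3] -/
theorem code_append (S : ℕ → ℕ → Bool) {A B : List (Fin k)} (h : ∀ u ∈ A, ∀ v ∈ B, decide (G.Adj u v) = S (c u) (c v)) :
    code G c (A ++ B) = combine S (code G c A) (code G c B) := by
  unfold code combine
  simp only [ofLex_toLex, List.map_append, zipWith_map_map, List.map_map]
  congr 1
  refine Prod.ext ?_ rfl
  dsimp only
  congr 1
  · refine List.map_congr_left fun u hu => ?_
    simp only [List.append_cancel_left_eq]
    exact List.map_congr_left fun v hv => h u hu v hv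
  · refine List.map_congr_left fun v hv => ?_
    simp only [List.append_cancel_right_eq]
    exact List.map_congr_left fun u hu => by rw [G.adj_comm]; exact h u hu v hv

end CGCanon

end

end Literature.Computability.Complexity
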